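import Mathlib.Algebra.BigOperators.Group.Finset.Basic
import Mathlib.Algebra.Order.BigOperators.Group.Finset
import Mathlib.Algebra.BigOperators.Ring.Finset
import Mathlib.Algebra.Group.Nat.Even
import Mathlib.Data.Finset.Lattice.Fold
import Mathlib.Data.Fintype.Basic
import Mathlib.Data.Fintype.BigOperators
import Mathlib.Data.Fintype.Prod
import Mathlib.Data.List.Basic
import HarnessLib

/-!
# Private-coin games: the value of a finite interactive proof against all provers

Trunk T-CPLX-CORE, information-theoretic companion of `InteractiveProofs.lean` (Arora–Barak
Def. 8.6: private-coin verifiers `IPVerifier`, deterministic provers `IPProver`, `acceptProb`,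
`Proves`). Soundness of an interactive proof quantifies over ALL prover strategies; this file
isolates the finite combinatorics of that quantifier, for one fixed input, with the machine model
stripped away:

* `PCGame R M` — a verifier given by `next : R → List M → M` (its message from its private coins
  `r : R` and the history) and `accept : R → List M → Prop`; the verifier speaks at even history
  lengths, the prover (a strategy `List M → M`, which never sees `r`) at odd ones; `play`,
  `transcript`.
* `Consistent r h` — the coins a prover must still reckon with after seeing `h` (every verifier
  message in `h` is the one `next` produces); `consistent_append_iff` (one more message).
* `opt n h` — **backward induction**: leaves count the consistent accepting coins, the verifier's
  turn SUMS over its messages (they split the consistent coins), the prover's turn takes the BEST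
  reply. `card_accept_play_le_opt` / `card_accept_transcript_le_opt`: **no strategy brings more than
  `opt k []` coin values to acceptance**; `card_accept_transcript_greedy`: the greedy strategy
  attains it, so `opt k [] / |R|` is exactly the soundness error against unbounded provers.
* `prod`, `opt_prod_le`, `opt_prod_nil_le` — **parallel composition**: with independent coins and
  "accept iff both accept", `opt_{G₁×G₂} ≤ opt_{G₁} · opt_{G₂}` against joint provers that may
  correlate their replies arbitrarily (the product rule for the soundness error of parallel
  repetition of private-coin proofs).

Why a separate layer: the analyses of concrete constant-round protocols (Goldwasser–Sipser set
lower bound, Aiello–Håstad upper bound, and the protocol of Akavia–Goldreich–Goldwasser–Moshkovitz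
App. D behind `Literature.Barriers.PneNP.AkaviaEtAl2006_complMemIPk`, for whose bottom-up discharge
plan this is written) bound `opt` by unfolding its recursion over their few rounds and feeding in
counting lemmas (`AffineHashing.lean`, `SetUpperBoundProtocol.lean`, `PlantedSampleHiding.lean`, …);
the passage to `IPVerifier.acceptProb` (coins and messages as bit vectors of the lengths fixed by
the verifier's polynomials, prover messages normalised by `List.takeD`) is a separate, purely
syntactic bridge. Mathlib only, all proved; [folklore] throughout (backward induction on game trees
with information sets reduced to histories, as in Babai–Moran's and Goldwasser–Sipser's analyses;
Arora–Barak §8.1 for the model and for "deterministic provers suffice").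

## References

* [AroraBarakCC2009] S. Arora, B. Barak, *Computational Complexity: A Modern Approach*, CUP 2009,
  §8.1, Def. 8.6, Lemma 8.7 and the remarks after it.
* L. Babai, S. Moran, *Arthur–Merlin games: a randomized proof system, and a hierarchy of
  complexity classes*, JCSS 36 (1988), §2 (game-tree evaluation: average at Arthur's nodes, max at
  Merlin's).
* O. Goldreich, *Modern Cryptography, Probabilistic Proofs and Pseudorandomness*, Springer 1999,
  App. C.1 (parallel repetition of interactive proofs reduces the error exponentially).
-/

namespace Literature.Computability.Complexity

open Finset

/-- A **finite private-coin game** (an interactive proof on ONE fixed input, information-theoretic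
layer): the verifier's private coins range over `R`, messages over `M`; `next r h` is the verifier's
message after the history `h` (consulted when `h` has even length: the verifier speaks first and the
parties alternate), and `accept r h` is its verdict on the final history. [cite: AroraBarakCC2009, Def. 8.6] -/
structure PCGame (R M : Type*) where
  /-- the verifier's next message from its coins and the history so far -/
  next : R → List M → M
  /-- the verifier's verdict from its coins and the complete history -/
  accept : R → List M → Prop

namespace PCGame

variable {R M : Type*} (G : PCGame R M)

/-- **Playing `n` more messages** from the history `h` against the (deterministic) prover strategy
`σ` (history ↦ reply; the prover never sees `r`): the mover is determined by the parity of the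
history length. [cite: AroraBarakCC2009, Def. 8.6] -/
def play (r : R) (σ : List M → M) : ℕ → List M → List M
  | 0, h => h
  | n + 1, h => play r σ n (h ++ [if Even h.length then G.next r h else σ h])

/-- The complete `k`-message transcript. [cite: AroraBarakCC2009, Def. 8.6] -/
def transcript (k : ℕ) (r : R) (σ : List M → M) : List M :=
  G.play r σ k []

/-- No more messages: the history is final. [folklore] -/
@[simp] theorem play_zero (r : R) (σ : List M → M) (h : List M) : G.play r σ 0 h = h := rfl

/-- One more message, by the party whose turn it is. [folklore] -/
theorem play_succ (r : R) (σ : List M → M) (n : ℕ) (h : List M) :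
    G.play r σ (n + 1) h = G.play r σ n (h ++ [if Even h.length then G.next r h else σ h]) := rfl

/-- **Coins consistent with a history**: every verifier message in `h` (even positions) is the one
`next` produces from the coins and the preceding messages. These are the coin values a prover must
still reckon with after seeing `h`. [folklore] -/
def Consistent (r : R) (h : List M) : Prop :=
  ∀ (h₁ : List M) (a : M) (h₂ : List M), h = h₁ ++ a :: h₂ → Even h₁.length → a = G.next r h₁

/-- Every coin value is consistent with the empty history. [folklore] -/
theorem consistent_nil (r : R) : G.Consistent r [] := by
  intro h₁ a h₂ hh _
  exact absurd hh.symm (List.append_ne_nil_of_right_ne_nil h₁ (List.cons_ne_nil a h₂))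

/-- Appending one message: consistency of `h ++ [x]` is consistency of `h` plus, if it was the
verifier's turn, `x = next r h`. [folklore] -/
theorem consistent_append_iff (r : R) (h : List M) (x : M) :
    G.Consistent r (h ++ [x]) ↔ G.Consistent r h ∧ (Even h.length → x = G.next r h) := by
  constructor
  · intro hc
    refine ⟨fun h₁ a h₂ hh he => hc h₁ a (h₂ ++ [x]) (by rw [hh]; simp) he,
      fun he => hc h x [] rfl he⟩
  · rintro ⟨hc, hx⟩ h₁ a h₂ hh he
    rcases List.eq_nil_or_concat h₂ with rfl | ⟨L, b, rfl⟩
    · -- the split is at the last message: `h ++ [x] = h₁ ++ [a]`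
      have hh' : h = h₁ ∧ x = a := by simpa using hh
      obtain ⟨rfl, rfl⟩ := hh'
      exact hx he
    · -- the split is inside `h`
      have hh' : h ++ [x] = (h₁ ++ a :: L) ++ [b] := by rw [hh]; simp
      obtain ⟨rfl, -⟩ := List.append_inj' hh' rfl
      exact hc h₁ a L rfl he

/-- On the verifier's turn the appended message is forced. [folklore] -/
theorem consistent_append_iff_of_even (r : R) {h : List M} (he : Even h.length) (x : M) :
    G.Consistent r (h ++ [x]) ↔ G.Consistent r h ∧ x = G.next r h := by
  rw [consistent_append_iff]
  exact ⟨fun ⟨h1, h2⟩ => ⟨h1, h2 he⟩, fun ⟨h1, h2⟩ => ⟨h1, fun _ => h2⟩⟩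

/-- On the prover's turn any appended message keeps consistency. [folklore] -/
theorem consistent_append_iff_of_not_even (r : R) {h : List M} (ho : ¬ Even h.length) (x : M) :
    G.Consistent r (h ++ [x]) ↔ G.Consistent r h := by
  rw [consistent_append_iff]
  exact ⟨fun ⟨h1, _⟩ => h1, fun h1 => ⟨h1, fun he => absurd he ho⟩⟩

variable [Fintype R] [Fintype M]

open scoped Classical in
/-- **The optimal continuation count** `opt n h`: the largest number of coin values, consistent
with `h`, that any prover can still bring to acceptance within `n` more messages — computed by
backward induction: at a leaf, count the consistent accepting coins; on the verifier's turn, SUM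
over its possible messages (they split the consistent coins into disjoint parts); on the prover's
turn, take the BEST reply. (The prover does not see `r`, but it sees `h`, and its optimal reply
depends on `h` only — this is why the maximum sits inside the sum.) [folklore] -/
noncomputable def opt : ℕ → List M → ℕ
  | 0, h => (univ.filter fun r => G.Consistent r h ∧ G.accept r h).card
  | n + 1, h =>
    if Even h.length then ∑ a : M, opt n (h ++ [a]) else univ.sup fun b : M => opt n (h ++ [b])

open scoped Classical in
/-- **No prover beats the backward-induction value**: for every deterministic strategy `σ`, the
coins consistent with `h` that `σ` brings to acceptance within `n` more messages number at most
`opt n h`. (Deterministic strategies suffice: a randomised prover is an average of deterministic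
ones, AB Remark after Lemma 8.7.) [cite: AroraBarakCC2009, §8.1 (Lemma 8.7 and remarks)] -/
theorem card_accept_play_le_opt (σ : List M → M) (n : ℕ) (h : List M) :
    (univ.filter fun r => G.Consistent r h ∧ G.accept r (G.play r σ n h)).card ≤ G.opt n h := by
  induction n generalizing h with
  | zero => simp [opt]
  | succ n ih =>
    by_cases he : Even h.length
    · -- verifier's turn: split the consistent coins by the message they produce
      simp only [play_succ, opt, he, if_true]
      rw [card_eq_sum_card_fiberwise (f := fun r => G.next r h) (t := univ) fun _ _ => mem_univ _]
      refine sum_le_sum fun a _ => ?_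
      refine le_trans (card_le_card fun r hr => ?_) (ih (h ++ [a]))
      simp only [mem_filter, mem_univ, true_and] at hr ⊢
      obtain ⟨⟨hc, hacc⟩, hra⟩ := hr
      rw [hra] at hacc
      exact ⟨(G.consistent_append_iff_of_even r he a).2 ⟨hc, hra.symm⟩, hacc⟩
    · -- prover's turn: its reply `σ h` is one of the candidates of the supremum
      simp only [play_succ, opt, he, if_false]
      refine le_trans ?_ (le_sup (f := fun b : M => G.opt n (h ++ [b])) (mem_univ (σ h)))
      refine le_trans (card_le_card fun r hr => ?_) (ih (h ++ [σ h]))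
      simp only [mem_filter, mem_univ, true_and] at hr ⊢
      exact ⟨(G.consistent_append_iff_of_not_even r he _).2 hr.1, hr.2⟩

open scoped Classical in
/-- **Soundness against all provers reduces to one number**: every strategy makes at most
`opt k []` of the `|R|` coin values accept the `k`-message game. [cite: AroraBarakCC2009, Def. 8.6] -/
theorem card_accept_transcript_le_opt (σ : List M → M) (k : ℕ) :
    (univ.filter fun r => G.accept r (G.transcript k r σ)).card ≤ G.opt k [] := by
  have h := G.card_accept_play_le_opt σ k []
  simp only [consistent_nil, true_and] at h
  exact h

/-! ### The value is attained -/

open scoped Classical in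
/-- **A best reply**: a message maximising the optimal continuation count after `h ++ [b]` with
`n` messages to go. [folklore] -/
noncomputable def bestReply [Nonempty M] (n : ℕ) (h : List M) : M :=
  Classical.choose (exists_max_image (univ : Finset M) (fun b => G.opt n (h ++ [b]))
    (univ_nonempty_iff.2 ‹Nonempty M›))

open scoped Classical in
/-- A best reply is at least as good as any reply. [folklore] -/
theorem opt_le_opt_bestReply [Nonempty M] (n : ℕ) (h : List M) (b : M) :
    G.opt n (h ++ [b]) ≤ G.opt n (h ++ [G.bestReply n h]) :=
  (Classical.choose_spec (exists_max_image (univ : Finset M) (fun b => G.opt n (h ++ [b]))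
    (univ_nonempty_iff.2 ‹Nonempty M›))).2 b (mem_univ b)

open scoped Classical in
/-- **The greedy prover** for a `k`-message game: after a history `h` (its turn), play a best
reply for the `k - |h| - 1` messages that remain. [folklore] -/
noncomputable def greedy [Nonempty M] (k : ℕ) : List M → M :=
  fun h => G.bestReply (k - h.length - 1) h

open scoped Classical in
/-- The greedy prover attains the backward-induction value from every aligned position:
if `|h| + n = k` then exactly `opt n h` consistent coins accept. [folklore] -/
theorem card_accept_play_greedy [Nonempty M] (k n : ℕ) (h : List M) (hk : h.length + n = k) :
    (univ.filter fun r => G.Consistent r h ∧ G.accept r (G.play r (G.greedy k) n h)).card =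
      G.opt n h := by
  induction n generalizing h with
  | zero => simp [opt]
  | succ n ih =>
    by_cases he : Even h.length
    · simp only [play_succ, opt, he, if_true]
      rw [card_eq_sum_card_fiberwise (f := fun r => G.next r h) (t := univ) fun _ _ => mem_univ _]
      refine sum_congr rfl fun a _ => ?_
      rw [← ih (h ++ [a]) (by simp; omega)]
      congr 1
      ext r
      simp only [mem_filter, mem_univ, true_and]
      constructor
      · rintro ⟨⟨hc, hacc⟩, hra⟩
        rw [hra] at hacc
        exact ⟨(G.consistent_append_iff_of_even r he a).2 ⟨hc, hra.symm⟩, hacc⟩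
      · rintro ⟨hc, hacc⟩
        obtain ⟨hc', hra⟩ := (G.consistent_append_iff_of_even r he a).1 hc
        refine ⟨⟨hc', ?_⟩, hra.symm⟩
        rw [← hra]
        exact hacc
    · simp only [play_succ, opt, he, if_false]
      have hg : G.greedy k h = G.bestReply n h := by
        simp only [greedy]
        congr 1
        omega
      rw [hg]
      have hih := ih (h ++ [G.bestReply n h]) (by simp; omega)
      rw [← show (univ.filter fun r => G.Consistent r (h ++ [G.bestReply n h]) ∧
          G.accept r (G.play r (G.greedy k) n (h ++ [G.bestReply n h]))).card =
          (univ.filter fun r => G.Consistent r h ∧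
            G.accept r (G.play r (G.greedy k) n (h ++ [G.bestReply n h]))).card from
        congrArg Finset.card (filter_congr fun r _ => by
          rw [G.consistent_append_iff_of_not_even r he])]
      rw [hih]
      exact le_antisymm (le_sup (f := fun b : M => G.opt n (h ++ [b])) (mem_univ _))
        (Finset.sup_le fun b _ => G.opt_le_opt_bestReply n h b)

open scoped Classical in
/-- **`opt k []` is exactly the best acceptance count over all provers** (upper bound
`card_accept_transcript_le_opt`, attained by the greedy prover). [cite: AroraBarakCC2009, Def. 8.6] -/
theorem card_accept_transcript_greedy [Nonempty M] (k : ℕ) :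
    (univ.filter fun r => G.accept r (G.transcript k r (G.greedy k))).card = G.opt k [] := by
  have h := G.card_accept_play_greedy k k [] (by simp)
  simp only [consistent_nil, true_and] at h
  exact h

/-! ### Parallel composition: the product bound -/

section Prod

variable {R₁ M₁ R₂ M₂ : Type*} (G₁ : PCGame R₁ M₁) (G₂ : PCGame R₂ M₂)

omit [Fintype R] [Fintype M] in
/-- **Two games in parallel**: independent coins `(r₁, r₂)`, paired messages, accept iff both
accept. The joint prover sees both histories and may correlate its replies. [folklore] -/
def prod : PCGame (R₁ × R₂) (M₁ × M₂) where
  next r h := (G₁.next r.1 (h.map Prod.fst), G₂.next r.2 (h.map Prod.snd))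
  accept r h := G₁.accept r.1 (h.map Prod.fst) ∧ G₂.accept r.2 (h.map Prod.snd)

omit [Fintype R] [Fintype M] in
/-- Consistency in the product is consistency of both projections. [folklore] -/
theorem consistent_prod_iff (r : R₁ × R₂) (h : List (M₁ × M₂)) :
    (G₁.prod G₂).Consistent r h ↔
      G₁.Consistent r.1 (h.map Prod.fst) ∧ G₂.Consistent r.2 (h.map Prod.snd) := by
  induction h using List.reverseRecOn with
  | nil => simp [consistent_nil]
  | append_singleton l x ih =>
    rw [consistent_append_iff, ih, List.map_append, List.map_append, List.map_singleton,
      List.map_singleton, consistent_append_iff, consistent_append_iff, List.length_map,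
      List.length_map]
    simp only [prod, Prod.ext_iff]
    tauto

variable [Fintype R₁] [Fintype M₁] [Fintype R₂] [Fintype M₂]

omit [Fintype R] [Fintype M] in
open scoped Classical in
/-- **The product bound for private-coin games**: running two games in parallel with independent
coins and accepting iff both accept, NO joint prover strategy — however it correlates its replies
across the two games — does better than the product of the two optimal counts:
`opt_{G₁ × G₂} n h ≤ opt_{G₁} n h₁ · opt_{G₂} n h₂`. (Backward induction: at the verifier's turn the
sum over paired messages factorises; at the prover's turn a best paired reply is no better than the
pair of best replies.) [folklore] -/
theorem opt_prod_le (n : ℕ) (h : List (M₁ × M₂)) :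
    (G₁.prod G₂).opt n h ≤ G₁.opt n (h.map Prod.fst) * G₂.opt n (h.map Prod.snd) := by
  induction n generalizing h with
  | zero =>
    simp only [opt]
    rw [← card_product]
    refine (card_le_card fun r hr => ?_)
    simp only [mem_filter, mem_univ, true_and, mem_product] at hr ⊢
    rw [consistent_prod_iff] at hr
    exact ⟨⟨hr.1.1, hr.2.1⟩, ⟨hr.1.2, hr.2.2⟩⟩
  | succ n ih =>
    have hlen₁ : (h.map Prod.fst).length = h.length := List.length_map _
    have hlen₂ : (h.map Prod.snd).length = h.length := List.length_map _
    by_cases he : Even h.length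
    · simp only [opt, he, hlen₁, hlen₂, if_true]
      rw [Fintype.sum_prod_type, sum_mul_sum]
      refine sum_le_sum fun a₁ _ => sum_le_sum fun a₂ _ => ?_
      have := ih (h ++ [(a₁, a₂)])
      simpa using this
    · simp only [opt, he, hlen₁, hlen₂, if_false]
      refine Finset.sup_le fun b _ => ?_
      have := ih (h ++ [b])
      simp only [List.map_append, List.map_singleton] at this
      exact this.trans (Nat.mul_le_mul
        (le_sup (f := fun b₁ : M₁ => G₁.opt n (h.map Prod.fst ++ [b₁])) (mem_univ b.1))
        (le_sup (f := fun b₂ : M₂ => G₂.opt n (h.map Prod.snd ++ [b₂])) (mem_univ b.2)))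

omit [Fintype R] [Fintype M] in
open scoped Classical in
/-- In particular for complete games: `opt_{G₁ × G₂} k [] ≤ opt_{G₁} k [] · opt_{G₂} k []` — the
soundness error of a parallel repetition is at most the product of the soundness errors.
[cite: AroraBarakCC2009, §8.1] -/
theorem opt_prod_nil_le (k : ℕ) :
    (G₁.prod G₂).opt k [] ≤ G₁.opt k [] * G₂.opt k [] := by
  simpa using opt_prod_le G₁ G₂ k []

end Prod

end PCGame

end Literature.Computability.Complexity
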